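import Mathlib
import HarnessLib
import Summits.Ventures.LatticeQCDFlow.Scaling.AutoregressiveProposalKLPinsker

/-!
# LatticeQCDFlow / Scaling — the training loss from per-step conditional-error floors:
# `#T·v²/2 ≤ KL(target ‖ autoregressive hybrid)` whenever `#T` steps of the order have conditional `L¹`
# error at least `v·Z`, and `#T·m ≤ KL` whenever they have conditional divergence at least `m` — general
# product spaces

HONEST FRAMING: exact (Metropolis-corrected) sampling algorithms for lattice gauge theory;
figures of merit are autocorrelation/cost numbers at stated couplings and volumes; no
continuum-physics claim.

Venture `LatticeQCDFlow` (cell pub-lqcd), topic `Scaling`, FANOUT row 30 (lean-1, GEN-21) — OUR WORK on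
THEORY-2.md §4 row C5: the ALGEBRAIC SPINE of the volume law, separated from the lattice.  The tree's
`Scaling/AutoregressiveProposalKLPinsker.sum_sq_condGap_le_two_mul_kl` (Pinsker along the order) says
`Σ_k δ_k² ≤ 2·KL(F/Z ‖ H_l)` for an autoregressive block `l` with squeezed normalised conditionals on a product
of probability spaces, `δ_k = Z⁻¹ ∫ |A_{s_k}F − q_{a_k}·A_{s_{k−1}}F| dπ`.  Here: if a set `T` of coordinates of
`l` (or a sub-list `S` of steps) has `δ ≥ v ≥ 0` at each of its steps then `#T·v²/2 ≤ KL` — so every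
per-step floor `v` that the lattice supplies (the plaquette mean of `Scaling/AutoregressiveGaugePlaquette
TVFloorAnyLink`, the small-ball floor of `Scaling/AutoregressiveGaugeAcceptanceCeilingHalf`, …) becomes an
EXTENSIVE loss floor once the witnessed steps are counted (`Scaling/TorusPlaquetteLastLinks`).

## What is proved (all [ours]; `π = ⊗_ι μ`, weight `F` measurable with `0 < c_F ≤ F ≤ C_F`, `Z = ∫F dπ`,
conditionals `q_a` measurable with `0 < c_q ≤ q_a ≤ C_q`, normalised in `a`; `l` duplicate-free, `q_a` not
reading the coordinates after `a` in `l`; the steps of `l` are the pairs `c = (a, later coordinates)` of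
`l.zip l.tails.tail`, with conditional error `gap c = ∫ |A_{c.2}F − q_{c.1}·A_{c.1 :: c.2}F| dπ`)

* **`kl_arHybrid_ge_length_mul_sq_of_stepFloor`** — `S` a sub-list of the steps, `0 ≤ v`,
  `v·Z ≤ gap c` for every `c ∈ S`:  `|S|·v²/2 ≤ KL(F/Z ‖ H_l)`.
* **`kl_arHybrid_ge_card_mul_sq_of_stepFloor`** — `T` a finite set of coordinates of `l`, `0 ≤ v`,
  `v·Z ≤ gap c` for every step `c` with `c.1 ∈ T`:  `#T·v²/2 ≤ KL(F/Z ‖ H_l)`.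

* **`kl_arHybrid_ge_length_mul_of_stepKL`**, **`kl_arHybrid_ge_card_mul_of_stepKL`** — the same with the
  per-step floor put directly on the mean conditional divergence `∫ (F/Z)·log(A_{c.2}F/(q_{c.1}·A_{c.1::c.2}F))
  ≥ m` (no Pinsker; the KL chain rule `integral_kl_arHybrid_eq_sum` and termwise non-negativity):
  `|S|·m ≤ KL`, `#T·m ≤ KL`.

(`KL(F/Z ‖ H_l) = ∫ (F/Z) log((F/Z)/H_l) dπ`, `H_l = (∏_{a∈l} q_a)·A_l F/Z` the hybrid density.)
NOT CLAIMED: anything lattice-specific; the floors themselves.  No `def`, no `sorry`, nothing cited as a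
fact beyond the tree.
-/

noncomputable section

namespace Summit.Ventures.LatticeQCDFlow.Theory2.Autoregressive

open MeasureTheory Function Set
open Summit.Ventures.LatticeQCDFlow.Exactness

variable {ι : Type*} [Fintype ι] [DecidableEq ι] {X : Type*} [MeasurableSpace X]
variable (μ : Measure X) [IsProbabilityMeasure μ]

/-- **EXTENSIVE LOSS FROM A PER-STEP FLOOR, sub-list form.**  If every step `c` of a sub-list `S` of the
autoregressive order has conditional `L¹` error `∫ |A_{c.2}F − q_{c.1}·A_{c.1::c.2}F| dπ ≥ v·Z` (`v ≥ 0`),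
then `|S|·v²/2 ≤ KL(F/Z ‖ H_l)`. [ours] -/
theorem kl_arHybrid_ge_length_mul_sq_of_stepFloor {q : ι → (ι → X) → ℝ} (hqm : ∀ a, Measurable (q a))
    {cq Cq : ℝ} (hcq : 0 < cq) (hqlo : ∀ a ω, cq ≤ q a ω) (hqhi : ∀ a ω, q a ω ≤ Cq)
    (hq1 : ∀ a ω, ∫ v, q a (update ω a v) ∂μ = 1)
    {F : (ι → X) → ℝ} (hFm : Measurable F) {cF CF : ℝ} (hcF : 0 < cF) (hFlo : ∀ ω, cF ≤ F ω)
    (hFhi : ∀ ω, F ω ≤ CF) (l : List ι) (hl : l.Nodup)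
    (hpw : l.Pairwise (fun a b => ∀ ω v, q a (update ω b v) = q a ω))
    (S : List (ι × List ι)) (hS : S.Sublist (l.zip l.tails.tail)) {v : ℝ} (hv0 : 0 ≤ v)
    (hv : ∀ c ∈ S, v * ∫ ω, F ω ∂Measure.pi (fun _ : ι => μ) ≤
      ∫ ω, |coordAvg μ c.2.toFinset F ω - q c.1 ω * coordAvg μ (c.1 :: c.2).toFinset F ω|
        ∂Measure.pi (fun _ : ι => μ)) :
    (S.length : ℝ) * v ^ 2 / 2 ≤
      ∫ ω, F ω / (∫ η, F η ∂Measure.pi (fun _ : ι => μ)) *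
          Real.log ((F ω / ∫ η, F η ∂Measure.pi (fun _ : ι => μ)) /
            ((l.map fun b => q b ω).prod * coordAvg μ l.toFinset F ω / ∫ η, F η ∂Measure.pi (fun _ : ι => μ)))
          ∂Measure.pi (fun _ : ι => μ) := by
  set Z : ℝ := ∫ η, F η ∂Measure.pi (fun _ : ι => μ) with hZ
  set KL : ℝ := ∫ ω, F ω / Z * Real.log ((F ω / Z) /
      ((l.map fun b => q b ω).prod * coordAvg μ l.toFinset F ω / Z)) ∂Measure.pi (fun _ : ι => μ) with hKL
  have hF0 : ∀ ω, 0 < F ω := fun ω => hcF.trans_le (hFlo ω)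
  have hFabs : ∀ ω, |F ω| ≤ CF := fun ω => by rw [abs_of_pos (hF0 ω)]; exact hFhi ω
  have hZpos : 0 < Z := by
    have h1 : ∫ _, cF ∂Measure.pi (fun _ : ι => μ) ≤ Z :=
      integral_mono (integrable_const cF) (integrable_pi_of_abs_le μ hFm hFabs) hFlo
    have h2 : ∫ _, cF ∂Measure.pi (fun _ : ι => μ) = cF := by
      rw [integral_const, smul_eq_mul, Measure.real, measure_univ, ENNReal.toReal_one, one_mul]
    linarith
  -- Pinsker along the order
  have hsum := sum_sq_condGap_le_two_mul_kl μ hqm hcq hqlo hqhi hq1 hFm hcF hFlo hFhi l hl hpw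
  set g : ι × List ι → ℝ := fun c =>
    (∫ ω, |coordAvg μ c.2.toFinset F ω - q c.1 ω * coordAvg μ (c.1 :: c.2).toFinset F ω|
      ∂Measure.pi (fun _ : ι => μ)) ^ 2 with hg
  have hg0 : ∀ c ∈ l.zip l.tails.tail, 0 ≤ g c := fun c _ => sq_nonneg _
  have hsub : (S.map g).sum ≤ ((l.zip l.tails.tail).map g).sum :=
    (hS.map g).sum_le_sum (fun x hx => by
      obtain ⟨c, hc, rfl⟩ := List.mem_map.1 hx
      exact hg0 c hc)
  -- each step of `S` contributes at least `(vZ)²`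
  have hterm : ∀ c ∈ S, (v * Z) ^ 2 ≤ g c := fun c hc =>
    pow_le_pow_left₀ (mul_nonneg hv0 hZpos.le) (hv c hc) 2
  have hconst : (S.map fun _ => (v * Z) ^ 2).sum = (S.length : ℝ) * (v * Z) ^ 2 := by
    rw [List.map_const', List.sum_replicate, nsmul_eq_mul]
  have hle : (S.length : ℝ) * (v * Z) ^ 2 ≤ (S.map g).sum := by
    rw [← hconst]
    exact List.sum_le_sum hterm
  -- assemble: `|S| v² Z² ≤ Σ g ≤ 2 Z² KL`
  have hchain : (S.length : ℝ) * (v * Z) ^ 2 ≤ 2 * Z ^ 2 * KL := hle.trans (hsub.trans hsum)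
  have hZ2 : 0 < Z ^ 2 := by positivity
  have key : (S.length : ℝ) * v ^ 2 / 2 * Z ^ 2 ≤ KL * Z ^ 2 := by
    have e1 : (S.length : ℝ) * (v * Z) ^ 2 = (S.length : ℝ) * v ^ 2 / 2 * Z ^ 2 * 2 := by ring
    have e2 : 2 * Z ^ 2 * KL = KL * Z ^ 2 * 2 := by ring
    rw [e1, e2] at hchain
    linarith
  exact le_of_mul_le_mul_right key hZ2

/-- **EXTENSIVE LOSS FROM A PER-STEP FLOOR, coordinate-indexed form.**  `T` a finite set of coordinates
of the block `l`; if every step `c` of the order whose coordinate `c.1` lies in `T` has conditional `L¹`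
error `≥ v·Z` (`v ≥ 0`), then `#T·v²/2 ≤ KL(F/Z ‖ H_l)`. [ours] -/
theorem kl_arHybrid_ge_card_mul_sq_of_stepFloor {q : ι → (ι → X) → ℝ} (hqm : ∀ a, Measurable (q a))
    {cq Cq : ℝ} (hcq : 0 < cq) (hqlo : ∀ a ω, cq ≤ q a ω) (hqhi : ∀ a ω, q a ω ≤ Cq)
    (hq1 : ∀ a ω, ∫ v, q a (update ω a v) ∂μ = 1)
    {F : (ι → X) → ℝ} (hFm : Measurable F) {cF CF : ℝ} (hcF : 0 < cF) (hFlo : ∀ ω, cF ≤ F ω)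
    (hFhi : ∀ ω, F ω ≤ CF) (l : List ι) (hl : l.Nodup)
    (hpw : l.Pairwise (fun a b => ∀ ω v, q a (update ω b v) = q a ω))
    (T : Finset ι) (hT : ∀ e ∈ T, e ∈ l) {v : ℝ} (hv0 : 0 ≤ v)
    (hv : ∀ c ∈ l.zip l.tails.tail, c.1 ∈ T → v * ∫ ω, F ω ∂Measure.pi (fun _ : ι => μ) ≤
      ∫ ω, |coordAvg μ c.2.toFinset F ω - q c.1 ω * coordAvg μ (c.1 :: c.2).toFinset F ω|
        ∂Measure.pi (fun _ : ι => μ)) :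
    (T.card : ℝ) * v ^ 2 / 2 ≤
      ∫ ω, F ω / (∫ η, F η ∂Measure.pi (fun _ : ι => μ)) *
          Real.log ((F ω / ∫ η, F η ∂Measure.pi (fun _ : ι => μ)) /
            ((l.map fun b => q b ω).prod * coordAvg μ l.toFinset F ω / ∫ η, F η ∂Measure.pi (fun _ : ι => μ)))
          ∂Measure.pi (fun _ : ι => μ) := by
  classical
  -- the witnessed steps: those whose coordinate lies in `T`
  set S : List (ι × List ι) := (l.zip l.tails.tail).filter (fun c => decide (c.1 ∈ T)) with hSdef
  have hS : S.Sublist (l.zip l.tails.tail) := List.filter_sublist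
  have hmemS : ∀ c ∈ S, c ∈ l.zip l.tails.tail ∧ c.1 ∈ T := fun c hc => by
    simpa [hSdef, List.mem_filter] using hc
  have hmain := kl_arHybrid_ge_length_mul_sq_of_stepFloor μ hqm hcq hqlo hqhi hq1 hFm hcF hFlo hFhi l hl
    hpw S hS hv0 (fun c hc => hv c (hmemS c hc).1 (hmemS c hc).2)
  -- `#T ≤ |S|`
  have hlen : T.card ≤ S.length := by
    have e1 : (S.map Prod.fst) = l.filter (fun e => decide (e ∈ T)) := by
      rw [hSdef]
      have h := List.filter_map (p := fun e : ι => decide (e ∈ T)) (f := Prod.fst) (l := l.zip l.tails.tail)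
      rw [List.map_fst_zip (by simp [List.length_tails])] at h
      rw [h]
      rfl
    have e2 : S.length = (l.filter (fun e => decide (e ∈ T))).length := by
      rw [← e1, List.length_map]
    rw [e2]
    have hsub : T ⊆ (l.filter (fun e => decide (e ∈ T))).toFinset := by
      intro e he
      rw [List.mem_toFinset, List.mem_filter]
      exact ⟨hT e he, by simpa using he⟩
    exact (Finset.card_le_card hsub).trans (List.toFinset_card_le _)
  have hcast : (T.card : ℝ) ≤ (S.length : ℝ) := by exact_mod_cast hlen
  have hv2 : 0 ≤ v ^ 2 / 2 := by positivity
  calc (T.card : ℝ) * v ^ 2 / 2 = (T.card : ℝ) * (v ^ 2 / 2) := by ring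
    _ ≤ (S.length : ℝ) * (v ^ 2 / 2) := mul_le_mul_of_nonneg_right hcast hv2
    _ = (S.length : ℝ) * v ^ 2 / 2 := by ring
    _ ≤ _ := hmain

/-! ## §2 From per-step divergence floors (no Pinsker) -/

/-- **EXTENSIVE LOSS FROM A PER-STEP DIVERGENCE FLOOR, sub-list form.**  If every step `c` of a sub-list
`S` of the autoregressive order has mean conditional divergence
`∫ (F/Z)·log(A_{c.2}F/(q_{c.1}·A_{c.1::c.2}F)) dπ ≥ m`, then `|S|·m ≤ KL(F/Z ‖ H_l)` (the KL chain rule;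
the other steps contribute `≥ 0`). [ours] -/
theorem kl_arHybrid_ge_length_mul_of_stepKL {q : ι → (ι → X) → ℝ} (hqm : ∀ a, Measurable (q a))
    {cq Cq : ℝ} (hcq : 0 < cq) (hqlo : ∀ a ω, cq ≤ q a ω) (hqhi : ∀ a ω, q a ω ≤ Cq)
    (hq1 : ∀ a ω, ∫ v, q a (update ω a v) ∂μ = 1)
    {F : (ι → X) → ℝ} (hFm : Measurable F) {cF CF : ℝ} (hcF : 0 < cF) (hFlo : ∀ ω, cF ≤ F ω)
    (hFhi : ∀ ω, F ω ≤ CF) (l : List ι)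
    (hpw : l.Pairwise (fun a b => ∀ ω v, q a (update ω b v) = q a ω))
    (S : List (ι × List ι)) (hS : S.Sublist (l.zip l.tails.tail)) {m : ℝ}
    (hm : ∀ c ∈ S, m ≤ ∫ ω, F ω / (∫ η, F η ∂Measure.pi (fun _ : ι => μ)) *
        Real.log (coordAvg μ c.2.toFinset F ω / (q c.1 ω * coordAvg μ (c.1 :: c.2).toFinset F ω))
        ∂Measure.pi (fun _ : ι => μ)) :
    (S.length : ℝ) * m ≤
      ∫ ω, F ω / (∫ η, F η ∂Measure.pi (fun _ : ι => μ)) *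
          Real.log ((F ω / ∫ η, F η ∂Measure.pi (fun _ : ι => μ)) /
            ((l.map fun b => q b ω).prod * coordAvg μ l.toFinset F ω / ∫ η, F η ∂Measure.pi (fun _ : ι => μ)))
          ∂Measure.pi (fun _ : ι => μ) := by
  -- the chain rule and termwise non-negativity
  rw [integral_kl_arHybrid_eq_sum μ hqm hcq hqlo hqhi hFm hcF hFlo hFhi l]
  have hnn := (integral_kl_arHybrid_nonneg μ hqm hcq hqlo hqhi hq1 hFm hcF hFlo hFhi l hpw).1
  set g : ι × List ι → ℝ := fun c => ∫ ω, F ω / (∫ η, F η ∂Measure.pi (fun _ : ι => μ)) *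
    Real.log (coordAvg μ c.2.toFinset F ω / (q c.1 ω * coordAvg μ (c.1 :: c.2).toFinset F ω))
    ∂Measure.pi (fun _ : ι => μ) with hg
  have hsub : (S.map g).sum ≤ ((l.zip l.tails.tail).map g).sum :=
    (hS.map g).sum_le_sum (fun x hx => by
      obtain ⟨c, hc, rfl⟩ := List.mem_map.1 hx
      exact hnn c hc)
  have hconst : (S.map fun _ => m).sum = (S.length : ℝ) * m := by
    rw [List.map_const', List.sum_replicate, nsmul_eq_mul]
  have hle : (S.length : ℝ) * m ≤ (S.map g).sum := by
    rw [← hconst]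
    exact List.sum_le_sum (fun c hc => hm c hc)
  exact hle.trans hsub

/-- **EXTENSIVE LOSS FROM A PER-STEP DIVERGENCE FLOOR, coordinate-indexed form.**  `T` a finite set of
coordinates of the block `l`; if every step whose coordinate lies in `T` has mean conditional divergence
`≥ m`, then `#T·m ≤ KL(F/Z ‖ H_l)` (for `m ≥ 0`). [ours] -/
theorem kl_arHybrid_ge_card_mul_of_stepKL {q : ι → (ι → X) → ℝ} (hqm : ∀ a, Measurable (q a))
    {cq Cq : ℝ} (hcq : 0 < cq) (hqlo : ∀ a ω, cq ≤ q a ω) (hqhi : ∀ a ω, q a ω ≤ Cq)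
    (hq1 : ∀ a ω, ∫ v, q a (update ω a v) ∂μ = 1)
    {F : (ι → X) → ℝ} (hFm : Measurable F) {cF CF : ℝ} (hcF : 0 < cF) (hFlo : ∀ ω, cF ≤ F ω)
    (hFhi : ∀ ω, F ω ≤ CF) (l : List ι)
    (hpw : l.Pairwise (fun a b => ∀ ω v, q a (update ω b v) = q a ω))
    (T : Finset ι) (hT : ∀ e ∈ T, e ∈ l) {m : ℝ} (hm0 : 0 ≤ m)
    (hm : ∀ c ∈ l.zip l.tails.tail, c.1 ∈ T → m ≤ ∫ ω, F ω / (∫ η, F η ∂Measure.pi (fun _ : ι => μ)) *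
        Real.log (coordAvg μ c.2.toFinset F ω / (q c.1 ω * coordAvg μ (c.1 :: c.2).toFinset F ω))
        ∂Measure.pi (fun _ : ι => μ)) :
    (T.card : ℝ) * m ≤
      ∫ ω, F ω / (∫ η, F η ∂Measure.pi (fun _ : ι => μ)) *
          Real.log ((F ω / ∫ η, F η ∂Measure.pi (fun _ : ι => μ)) /
            ((l.map fun b => q b ω).prod * coordAvg μ l.toFinset F ω / ∫ η, F η ∂Measure.pi (fun _ : ι => μ)))
          ∂Measure.pi (fun _ : ι => μ) := by
  classical
  set S : List (ι × List ι) := (l.zip l.tails.tail).filter (fun c => decide (c.1 ∈ T)) with hSdef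
  have hS : S.Sublist (l.zip l.tails.tail) := List.filter_sublist
  have hmemS : ∀ c ∈ S, c ∈ l.zip l.tails.tail ∧ c.1 ∈ T := fun c hc => by
    simpa [hSdef, List.mem_filter] using hc
  have hmain := kl_arHybrid_ge_length_mul_of_stepKL μ hqm hcq hqlo hqhi hq1 hFm hcF hFlo hFhi l hpw S hS
    (fun c hc => hm c (hmemS c hc).1 (hmemS c hc).2)
  have hlen : T.card ≤ S.length := by
    have e1 : (S.map Prod.fst) = l.filter (fun e => decide (e ∈ T)) := by
      rw [hSdef]
      have h := List.filter_map (p := fun e : ι => decide (e ∈ T)) (f := Prod.fst) (l := l.zip l.tails.tail)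
      rw [List.map_fst_zip (by simp [List.length_tails])] at h
      rw [h]
      rfl
    have e2 : S.length = (l.filter (fun e => decide (e ∈ T))).length := by
      rw [← e1, List.length_map]
    rw [e2]
    have hsub : T ⊆ (l.filter (fun e => decide (e ∈ T))).toFinset := by
      intro e he
      rw [List.mem_toFinset, List.mem_filter]
      exact ⟨hT e he, by simpa using he⟩
    exact (Finset.card_le_card hsub).trans (List.toFinset_card_le _)
  have hcast : (T.card : ℝ) ≤ (S.length : ℝ) := by exact_mod_cast hlen
  exact (mul_le_mul_of_nonneg_right hcast hm0).trans hmain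

end Summit.Ventures.LatticeQCDFlow.Theory2.Autoregressive

end
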